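/-
Copyright (c) 2026 the pub-hodgecm-mathlib formalisation cell (harness21).  Prover seat hodgecm-mathlib-K2E3-p12 (g5), Track B «K2-LIT» ∕ h413
(`stmt-HodgeConjecture-24833`), line `K2_E3_EllipticInputs`, unit U12-d, §L (G⁺-b)∕(K5c): THE CHAIN «χ̃-twisted regular nilpotent orbital integral of 𝓕f
= c·γ₀·(c′·∫ f·A_n + c₀·∫ f·Fr₀)» FOR `2n ≥ N(f)`.  2026-09-04.
-/
import Summits.HodgeConjecture.HodgeConjecture.Theorems.K2E3GL2TwistedKAverage                       -- (K5b) (this seat): K-averages, constancy exponent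
import Summits.HodgeConjecture.HodgeConjecture.Theorems.K2E3GL2NilpotentFourierLinePointwise           -- ★ p857344 (K2E5-p17 g3): (L2′)
import Summits.HodgeConjecture.HodgeConjecture.Theorems.K2E3LocalFieldQuadraticCharLineInversionRamified -- ★ p857477 (K2E5-p17 g3): (T1) `exists_lineInversion_consts_of_quadratic`
import Summits.HodgeConjecture.HodgeConjecture.Theorems.K2E3LocalFieldQuadraticCharTruncation         -- ★ p857512 (K2E5-p17 g3): (T2-quant)
import Summits.HodgeConjecture.HodgeConjecture.Theorems.K2E3LocalFieldQuadraticWeightEventuallyConst   -- ★ p857503 (K2E5-p10 g4): `norm_truncWeight_le`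
import Summits.HodgeConjecture.HodgeConjecture.Theorems.K2E3GL2TwistedSliceZeroTerm                    -- ★ p857357 (K2E5-p10 g4): (K2) zero-term density
import Literature.NumberTheory.Automorphic.AddCharConductorExponent                                    -- ★ `exists_hasConductorExp`, `primePowBall_antitone`
import HarnessLib

/-!
# K2_E3 road (h413), §L — (G⁺-b)∕(K5c): the chain identity for the `χ̃`-twisted regular nilpotent Fourier transform

Cell `pub/hodgecm-mathlib` (D-0151), Track B, seat K2E3-p12 (g5), §L line lead (road «U-iso-T»).  `--supports stmt-HodgeConjecture-24833 --as helper`; THEOREMS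
ONLY (no definition ∕ instance ∕ notation ∕ named fact ∕ `sorry`); never imports `Cruxes/…/Lines`.  Count-neutral plumbing for the hosted leaf (LBGL-2b-Tw)
`sig_K2E3GL2TwistedRegularNilpotentFourier` (U12 ED. 14 :797).

With `χ̃`, `ω_n(y) = 1[y ∉ 𝔭^{2n}]·χ̃(y)·‖y‖⁻¹`, `A_n(X) = ∫_K χ̃(det k)·ω_n((k⁻¹Xk)₁₀) dκ` (frozen currency) and `G_k(s) = ∫_{F³} f(k[[r₀,r₁],[s,r₂]]k⁻¹) dr`:
* §1 `lineIntegral_eq_of_const_on_ball` — for `G ∈ 𝒮(F)` constant on `𝔭^N`, `N ≤ 2n`: `∫ χ̃·Ĝ = γ₀·∫ (ω_n + (c₀∕μ(𝔭^{2n}))·1_{𝔭^{2n}})·G` ((T1) ★ p857477 +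
  (T2-quant) ★ p857512: the regularised zeta value is the truncated integral, and `c₀·G(0)` is `c₀∕μ(𝔭^{2n})·∫_{𝔭^{2n}} G`);
  `integral_extend_mul_det_eq` — `∫ χ̃(t·det k)·Ĝ_k(t) dt = χ̃(det k)·∫ χ̃(t)·Ĝ_k(t) dt`.
* §2 **`exists_consts_twistedOrbitalFourier_eq`** — THE CHAIN: constants `γ₀ c₀` ((T1)), `c > 0` ((L2′) ★ p857344), `c′ > 0` ((K1′) ★ p857405) and the regular
  zero-term density `Fr₀` ((K2) ★ p857357 at `a = 1`) such that for every `f ∈ C_c^∞(𝔤𝔩₂(F))` and all `n ≥ n₀(f)`: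
  `∫ χ̃(t·det k)·𝓕f(k·tE₁₂·k⁻¹) d(κ⊗dx) = c·γ₀·c′·∫ f·A_n dμ𝔤 + c·γ₀·c₀·∫ f·Fr₀ dμ𝔤`.

HONEST LABEL: HC_CM is proved only modulo the 7 printed citations (2 remaining named inputs: hLiu418 = stmt-HodgeConjecture-24832, h413 = stmt-HodgeConjecture-24833)
until rung 0 closes; count-neutral plumbing.

References: [HarishChandra1999AdmissibleDistributions] Harish-Chandra (DeBacker–Sally) (1999), Thm. 4.4 p. 11, Lemma 5.2, §7, Lemma 7.8; [Tate1950] Tate's thesis §2.5;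
[LabesseLanglands1979] Labesse–Langlands (1979), §2, §5.
-/

set_option autoImplicit false
set_option linter.dupNamespace false   -- `Summit.HodgeConjecture.HodgeConjecture.…` (D-0017 nested layout; lakefile exemption for Summits)

noncomputable section

open MeasureTheory Measure Filter Topology TopologicalSpace Set
open scoped MatrixGroups NNReal ENNReal
open Literature.NumberTheory.Rogawski1990 Literature.NumberTheory.Automorphic Literature.NumberTheory.Automorphic.LocalFieldHaar
open Literature.NumberTheory.GaloisRepresentations Literature.NumberTheory.GaloisRepresentations.IsNonarchimedeanLocalField
open Summit.HodgeConjecture.HodgeConjecture.Cruxes.H413.K2E3LocalFieldQuadraticCharSignWeight (norm_extend_le_one)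
open Summit.HodgeConjecture.HodgeConjecture.Cruxes.H413.K2E3LocalFieldQuadraticWeightEventuallyConst (norm_truncWeight_le)
open Summit.HodgeConjecture.HodgeConjecture.Cruxes.H413.K2E3LocalFieldQuadraticCharLineInversionRamified (exists_lineInversion_consts_of_quadratic)
open Summit.HodgeConjecture.HodgeConjecture.Cruxes.H413.K2E3LocalFieldQuadraticCharTruncation (setIntegral_compl_primePowBall_even_eq_of_quadratic)
open Summit.HodgeConjecture.HodgeConjecture.Cruxes.H413.K2E3GL2NilpotentFourierLinePointwise (matrixFourier_conjNilp_eq_fourierSB integral_prod_mul_matrixFourier_conjNilp_eq)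
open Summit.HodgeConjecture.HodgeConjecture.Cruxes.H413.K2E3GL2TwistedLinePairingBochner (integral_twistedLinePairing)
open Summit.HodgeConjecture.HodgeConjecture.Cruxes.H413.K2E3GL2TwistedSliceZeroTerm (exists_twistedSliceZeroTerm_density)
open Summit.HodgeConjecture.HodgeConjecture.Cruxes.H413.K2E3GL2TwistedKAverage

namespace Summit.HodgeConjecture.HodgeConjecture.Cruxes.H413.K2E3GL2TwistedNilpotentFourierChain

variable {F : Type*} [Field F] [ValuativeRel F] [TopologicalSpace F] [IsNonarchimedeanLocalField F] [MeasurableSpace F] [BorelSpace F]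
  (dx : Measure F) [dx.IsAddHaarMeasure] (χ : QuasiChar F)

/-! ## §1  The line identity for a slice function constant on a small ball -/

/-- The weight `ω_n + λ·1_{𝔭^{2n}}` is measurable. [folklore] -/
theorem measurable_truncWeight_add_indicator (n : ℕ) (lam : ℂ) :
    Measurable fun y : F => (primePowBall F (2 * (n : ℤ)))ᶜ.indicator
        (fun y => Function.extend ((↑) : Fˣ → F) (fun u => ((χ u : ℂˣ) : ℂ)) 0 y * ((((normAbs F y)⁻¹ : ℝ≥0) : ℝ) : ℂ)) y +
      lam * (primePowBall F (2 * (n : ℤ))).indicator (fun _ => (1 : ℂ)) y := by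
  have hm : Measurable fun y : F => Function.extend ((↑) : Fˣ → F) (fun u => ((χ u : ℂˣ) : ℂ)) 0 y * ((((normAbs F y)⁻¹ : ℝ≥0) : ℝ) : ℂ) :=
    (TateDirect.measurable_extend χ).mul (Complex.measurable_ofReal.comp (measurable_coe_nnreal_real.comp measurable_inv_normAbs))
  exact (hm.indicator (measurableSet_primePowBall _).compl).add
    (measurable_const.mul (measurable_const.indicator (measurableSet_primePowBall _)))

omit [MeasurableSpace F] [BorelSpace F] in
/-- The weight `ω_n + λ·1_{𝔭^{2n}}` is bounded by `q^{2n} + ‖λ‖`. [folklore] -/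
theorem norm_truncWeight_add_indicator_le (hχ2 : ∀ u, χ u * χ u = 1) (n : ℕ) (lam : ℂ) (y : F) :
    ‖(primePowBall F (2 * (n : ℤ)))ᶜ.indicator
        (fun y => Function.extend ((↑) : Fˣ → F) (fun u => ((χ u : ℂˣ) : ℂ)) 0 y * ((((normAbs F y)⁻¹ : ℝ≥0) : ℝ) : ℂ)) y +
      lam * (primePowBall F (2 * (n : ℤ))).indicator (fun _ => (1 : ℂ)) y‖ ≤ (residueFieldCard F : ℝ) ^ (2 * (n : ℤ)) + ‖lam‖ := by
  refine (norm_add_le _ _).trans (add_le_add (norm_truncWeight_le χ hχ2 _ y) ?_)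
  rw [norm_mul]
  refine (mul_le_mul_of_nonneg_left ?_ (norm_nonneg _)).trans (le_of_eq (mul_one _))
  by_cases hy : y ∈ primePowBall F (2 * (n : ℤ))
  · rw [Set.indicator_of_mem hy, norm_one]
  · rw [Set.indicator_of_notMem hy, norm_zero]; exact zero_le_one

/-- **The line identity for `G` constant on `𝔭^N`, `N ≤ 2n`**: given the (T1) inversion `∫ χ̃·Ĝ = γ₀·(Z₀(G) + c₀·G 0)` on `𝒮(F)`,
`∫ χ̃·Ĝ dμ = γ₀ · ∫ (ω_n + (c₀∕μ(𝔭^{2n}))·1_{𝔭^{2n}})·G dμ` — (T2-quant) ★ turns `Z₀(G)` into `∫ ω_n·G`, and `c₀·G(0) = (c₀∕μ(𝔭^{2n}))·∫_{𝔭^{2n}} G`.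
[cite: Tate1950, §2.5] [cite: HarishChandra1999AdmissibleDistributions, Lemma 7.8] -/
theorem lineIntegral_eq_of_const_on_ball (hχ2 : ∀ u, χ u * χ u = 1) (hχ1 : ∃ u, χ u ≠ 1) (ψ : AddChar F Circle) {γ₀ c₀ : ℂ}
    (hT1 : ∀ G ∈ SchwartzBruhat F,
      ∫ t, Function.extend ((↑) : Fˣ → F) (fun u => ((χ u : ℂˣ) : ℂ)) 0 t * fourierSB ψ dx G t ∂dx =
        γ₀ * ((∫ s, Function.extend ((↑) : Fˣ → F) (fun u => ((χ u : ℂˣ) : ℂ)) 0 s * ((((normAbs F s)⁻¹ : ℝ≥0) : ℝ) : ℂ) *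
          (G s - (primePowBall F 0).indicator (fun _ => G 0) s) ∂dx) + c₀ * G 0))
    {G : F → ℂ} (hG : G ∈ SchwartzBruhat F) {N : ℤ} (hGN : ∀ s ∈ primePowBall F N, G s = G 0) {n : ℕ} (hn : N ≤ 2 * (n : ℤ)) :
    ∫ t, Function.extend ((↑) : Fˣ → F) (fun u => ((χ u : ℂˣ) : ℂ)) 0 t * fourierSB ψ dx G t ∂dx =
      γ₀ * ∫ s, ((primePowBall F (2 * (n : ℤ)))ᶜ.indicator
          (fun y => Function.extend ((↑) : Fˣ → F) (fun u => ((χ u : ℂˣ) : ℂ)) 0 y * ((((normAbs F y)⁻¹ : ℝ≥0) : ℝ) : ℂ)) s +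
        (c₀ / (dx.real (primePowBall F (2 * (n : ℤ))) : ℂ)) * (primePowBall F (2 * (n : ℤ))).indicator (fun _ => (1 : ℂ)) s) * G s ∂dx := by
  haveI : T2Space F := (isLocalField F).toT2Space
  haveI : LocallyCompactSpace F := (isLocalField F).toLocallyCompactSpace
  have hGi : Integrable G dx := hG.1.continuous.integrable_of_hasCompactSupport hG.2
  have hμpos : 0 < dx.real (primePowBall F (2 * (n : ℤ))) := measureReal_primePowBall_pos dx _
  -- (T1) then (T2-quant)
  rw [hT1 G hG, ← setIntegral_compl_primePowBall_even_eq_of_quadratic dx χ hχ2 hχ1 hG hGN hn]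
  -- the truncated integral as an integral of the indicator weight
  have h1 : ∫ s in (primePowBall F (2 * (n : ℤ)))ᶜ, Function.extend ((↑) : Fˣ → F) (fun u => ((χ u : ℂˣ) : ℂ)) 0 s *
        ((((normAbs F s)⁻¹ : ℝ≥0) : ℝ) : ℂ) * G s ∂dx =
      ∫ s, (primePowBall F (2 * (n : ℤ)))ᶜ.indicator
          (fun y => Function.extend ((↑) : Fˣ → F) (fun u => ((χ u : ℂˣ) : ℂ)) 0 y * ((((normAbs F y)⁻¹ : ℝ≥0) : ℝ) : ℂ)) s * G s ∂dx := by
    rw [← integral_indicator (measurableSet_primePowBall _).compl]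
    refine integral_congr_ae (Eventually.of_forall fun s => ?_)
    simp only
    by_cases hs : s ∈ (primePowBall F (2 * (n : ℤ)))ᶜ
    · rw [Set.indicator_of_mem hs, Set.indicator_of_mem hs]
    · rw [Set.indicator_of_notMem hs, Set.indicator_of_notMem hs, zero_mul]
  -- the zero term as an integral over the ball
  have h2 : ∫ s, (primePowBall F (2 * (n : ℤ))).indicator (fun _ => (1 : ℂ)) s * G s ∂dx = (dx.real (primePowBall F (2 * (n : ℤ))) : ℂ) * G 0 := by
    have : (fun s => (primePowBall F (2 * (n : ℤ))).indicator (fun _ => (1 : ℂ)) s * G s) = (primePowBall F (2 * (n : ℤ))).indicator G := by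
      funext s
      by_cases hs : s ∈ primePowBall F (2 * (n : ℤ))
      · rw [Set.indicator_of_mem hs, Set.indicator_of_mem hs, one_mul]
      · rw [Set.indicator_of_notMem hs, Set.indicator_of_notMem hs, zero_mul]
    rw [this, integral_indicator (measurableSet_primePowBall _)]
    have hball : ∀ s ∈ primePowBall F (2 * (n : ℤ)), G s = G 0 := fun s hs => hGN s (primePowBall_antitone hn hs)
    rw [setIntegral_congr_fun (measurableSet_primePowBall _) hball, setIntegral_const, Complex.real_smul]
  -- integrability of the two weighted integrands
  have hI1 : Integrable (fun s => (primePowBall F (2 * (n : ℤ)))ᶜ.indicator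
      (fun y => Function.extend ((↑) : Fˣ → F) (fun u => ((χ u : ℂˣ) : ℂ)) 0 y * ((((normAbs F y)⁻¹ : ℝ≥0) : ℝ) : ℂ)) s * G s) dx := by
    refine hGi.bdd_mul (c := (residueFieldCard F : ℝ) ^ (2 * (n : ℤ))) ?_ (Eventually.of_forall fun s => norm_truncWeight_le χ hχ2 _ s)
    have := measurable_truncWeight_add_indicator χ n 0
    simp only [zero_mul, add_zero] at this
    exact this.aestronglyMeasurable
  have hI2 : Integrable (fun s => (primePowBall F (2 * (n : ℤ))).indicator (fun _ => (1 : ℂ)) s * G s) dx := by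
    refine hGi.bdd_mul (c := 1) (measurable_const.indicator (measurableSet_primePowBall _)).aestronglyMeasurable
      (Eventually.of_forall fun s => ?_)
    by_cases hs : s ∈ primePowBall F (2 * (n : ℤ))
    · rw [Set.indicator_of_mem hs, norm_one]
    · rw [Set.indicator_of_notMem hs, norm_zero]; exact zero_le_one
  -- assemble
  have hsplit : ∫ s, ((primePowBall F (2 * (n : ℤ)))ᶜ.indicator
          (fun y => Function.extend ((↑) : Fˣ → F) (fun u => ((χ u : ℂˣ) : ℂ)) 0 y * ((((normAbs F y)⁻¹ : ℝ≥0) : ℝ) : ℂ)) s +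
        (c₀ / (dx.real (primePowBall F (2 * (n : ℤ))) : ℂ)) * (primePowBall F (2 * (n : ℤ))).indicator (fun _ => (1 : ℂ)) s) * G s ∂dx =
      (∫ s, (primePowBall F (2 * (n : ℤ)))ᶜ.indicator
          (fun y => Function.extend ((↑) : Fˣ → F) (fun u => ((χ u : ℂˣ) : ℂ)) 0 y * ((((normAbs F y)⁻¹ : ℝ≥0) : ℝ) : ℂ)) s * G s ∂dx) +
      (c₀ / (dx.real (primePowBall F (2 * (n : ℤ))) : ℂ)) * ∫ s, (primePowBall F (2 * (n : ℤ))).indicator (fun _ => (1 : ℂ)) s * G s ∂dx := by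
    rw [← integral_const_mul, ← integral_add hI1 (hI2.const_mul _)]
    refine integral_congr_ae (Eventually.of_forall fun s => ?_)
    simp only
    ring
  rw [hsplit, h1, h2]
  have hne : (dx.real (primePowBall F (2 * (n : ℤ))) : ℂ) ≠ 0 := by exact_mod_cast hμpos.ne'
  field_simp

omit [ValuativeRel F] [IsNonarchimedeanLocalField F] [BorelSpace F] [dx.IsAddHaarMeasure] in
/-- `∫ χ̃(t·det k)·Φ(t) dt = χ̃(det k)·∫ χ̃(t)·Φ(t) dt` for `k ∈ GL₂` (any `Φ`). [folklore] -/
theorem integral_extend_mul_det_eq (k : GL (Fin 2) F) (Φ : F → ℂ) :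
    ∫ t, Function.extend ((↑) : Fˣ → F) (fun u => ((χ u : ℂˣ) : ℂ)) 0 (t * ((k : Matrix (Fin 2) (Fin 2) F)).det) * Φ t ∂dx =
      Function.extend ((↑) : Fˣ → F) (fun u => ((χ u : ℂˣ) : ℂ)) 0 ((k : Matrix (Fin 2) (Fin 2) F)).det *
        ∫ t, Function.extend ((↑) : Fˣ → F) (fun u => ((χ u : ℂˣ) : ℂ)) 0 t * Φ t ∂dx := by
  have hd : ((k : Matrix (Fin 2) (Fin 2) F)).det ≠ 0 := by
    rw [← Matrix.GeneralLinearGroup.val_det_apply]; exact (Matrix.GeneralLinearGroup.det k).ne_zero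
  rw [← integral_const_mul]
  refine integral_congr_ae (Eventually.of_forall fun t => ?_)
  simp only
  rw [extend_mul_of_ne_zero_right χ t hd]
  ring

/-! ## §2  The chain identity -/

set_option maxHeartbeats 800000 in
/-- **THE CHAIN**: there are `γ₀ c₀ : ℂ` ((T1)), `c > 0` ((L2′)), `c′ > 0` ((K1′)) and a regular zero-term density `Fr₀` ((K2) at `a = 1`) such that for every
`f ∈ C_c^∞(𝔤𝔩₂(F))` and all `n ≥ n₀(f)`:
`∫_{K×F} χ̃(t·det k)·𝓕_ψ f(k·tE₁₂·k⁻¹) d(κ⊗dx) = c·γ₀·c′ · ∫ f·A_n dμ𝔤 + c·γ₀·c₀ · ∫ f·Fr₀ dμ𝔤`.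
[cite: HarishChandra1999AdmissibleDistributions, Thm. 4.4 p. 11, Lemma 5.2, Lemma 7.8] [cite: LabesseLanglands1979, §5] [cite: Tate1950, §2.5] -/
theorem exists_consts_twistedOrbitalFourier_eq [CharZero F] {ψ : AddChar F Circle} (hψ : ψ.IsContinuousNontrivial) (hχ2 : ∀ u, χ u * χ u = 1) (hχ1 : ∃ u, χ u ≠ 1)
    [MeasurableSpace (GL (Fin 2) F)] [BorelSpace (GL (Fin 2) F)] [MeasurableSpace (Matrix (Fin 2) (Fin 2) F)] [BorelSpace (Matrix (Fin 2) (Fin 2) F)]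
    (μ𝔤 : Measure (Matrix (Fin 2) (Fin 2) F)) [μ𝔤.IsAddHaarMeasure] (κ : Measure ↥(glInt 2 F)) [IsHaarMeasure κ] :
    ∃ (γ₀ c₀ : ℂ) (c c' : ℝ), 0 < c ∧ 0 < c' ∧ ∃ Fr₀ : Matrix (Fin 2) (Fin 2) F → ℂ, LocallyIntegrable Fr₀ μ𝔤 ∧
      (∀ X : Matrix (Fin 2) (Fin 2) F, IsUnit X.charpoly.discr → ∀ᶠ Y in 𝓝 X, Fr₀ Y = Fr₀ X) ∧
      (∀ C : Set (Matrix (Fin 2) (Fin 2) F), IsCompact C → ∃ B : ℝ, ∀ X ∈ C, ((NNReal.sqrt (normAbs F X.charpoly.discr) : ℝ≥0) : ℝ) * ‖Fr₀ X‖ ≤ B) ∧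
      ∀ f : Matrix (Fin 2) (Fin 2) F → ℂ, IsLocSmooth f → ∃ n₀ : ℕ, ∀ n : ℕ, n₀ ≤ n →
        ∫ p : ↥(glInt 2 F) × F, Function.extend ((↑) : Fˣ → F) (fun u => ((χ u : ℂˣ) : ℂ)) 0 (p.2 * (((p.1 : GL (Fin 2) F) : Matrix (Fin 2) (Fin 2) F)).det) *
            (fun Y : Matrix (Fin 2) (Fin 2) F => ∫ X, ((ψ (Matrix.trace (Y * X)) : Circle) : ℂ) * f X ∂μ𝔤)
              (((p.1 : GL (Fin 2) F) : Matrix (Fin 2) (Fin 2) F) * !![0, p.2; 0, 0] * ((((p.1 : GL (Fin 2) F))⁻¹ : GL (Fin 2) F) : Matrix (Fin 2) (Fin 2) F)) ∂(κ.prod dx) =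
          (c * γ₀ * c' : ℂ) * ∫ X, f X * ∫ k : ↥(glInt 2 F),
              Function.extend ((↑) : Fˣ → F) (fun u => ((χ u : ℂˣ) : ℂ)) 0 (((k : GL (Fin 2) F) : Matrix (Fin 2) (Fin 2) F)).det *
                (primePowBall F (2 * (n : ℤ)))ᶜ.indicator
                  (fun y => Function.extend ((↑) : Fˣ → F) (fun u => ((χ u : ℂˣ) : ℂ)) 0 y * ((((normAbs F y)⁻¹ : ℝ≥0) : ℝ) : ℂ))
                  ((((((k : GL (Fin 2) F))⁻¹ : GL (Fin 2) F) : Matrix (Fin 2) (Fin 2) F) * X * ((k : GL (Fin 2) F) : Matrix (Fin 2) (Fin 2) F)) 1 0) ∂κ ∂μ𝔤 +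
          (c * γ₀ * c₀ : ℂ) * ∫ X, f X * Fr₀ X ∂μ𝔤 := by
  haveI : T2Space F := (isLocalField F).toT2Space
  haveI : LocallyCompactSpace F := (isLocalField F).toLocallyCompactSpace
  haveI : SecondCountableTopology F := secondCountableTopology_localField F
  haveI : LocallyCompactSpace (Matrix (Fin 2) (Fin 2) F) := Pi.locallyCompactSpace_of_finite
  haveI : BorelSpace ↥(glInt 2 F) := Subtype.borelSpace _
  haveI : CompactSpace ↥(glInt 2 F) := isCompact_iff_compactSpace.1 (isCompact_glInt 2 F)
  haveI : IsFiniteMeasure κ := CompactSpace.isFiniteMeasure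
  -- the constants
  obtain ⟨m, hm⟩ := hψ.exists_hasConductorExp
  obtain ⟨γ₀, c₀, -, -, hT1⟩ := exists_lineInversion_consts_of_quadratic dx χ hχ2 hχ1 ψ hψ.1 hm
  obtain ⟨c, hc, hL2⟩ := integral_prod_mul_matrixFourier_conjNilp_eq ψ hψ μ𝔤 κ dx
  obtain ⟨cS, -, hSB⟩ := matrixFourier_conjNilp_eq_fourierSB ψ hψ μ𝔤 dx
  obtain ⟨c', hc', hK1⟩ := integral_twistedLinePairing dx μ𝔤
  obtain ⟨Fr₀, hFr₀i, hFr₀rep, hFr₀lc, hFr₀bd⟩ := exists_twistedSliceZeroTerm_density hψ μ𝔤 κ dx χ 1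
  refine ⟨γ₀, c₀, c, c', hc, hc', Fr₀, hFr₀i, hFr₀lc, hFr₀bd, fun f hf => ?_⟩
  -- one constancy exponent for all `G_k`
  obtain ⟨N, hN⟩ := exists_forall_sliceFn_eq_of_mem_primePowBall dx hf
  refine ⟨N.toNat, fun n hn => ?_⟩
  have hNn : N ≤ 2 * (n : ℤ) := by
    have : N ≤ (N.toNat : ℤ) := Int.self_le_toNat N
    omega
  -- measurability and boundedness of the detector `χ̃ ∘ det` on `K` and of the weight `W(k,t) = χ̃(t·det k)`
  have hdetc : Continuous fun k : ↥(glInt 2 F) => (((k : GL (Fin 2) F) : Matrix (Fin 2) (Fin 2) F)).det :=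
    (Continuous.matrix_det Units.continuous_val).comp continuous_subtype_val
  have hχK : Measurable fun k : ↥(glInt 2 F) => Function.extend ((↑) : Fˣ → F) (fun u => ((χ u : ℂˣ) : ℂ)) 0 (((k : GL (Fin 2) F) : Matrix (Fin 2) (Fin 2) F)).det :=
    (TateDirect.measurable_extend χ).comp hdetc.measurable
  have hχKb : ∀ k : ↥(glInt 2 F), ‖Function.extend ((↑) : Fˣ → F) (fun u => ((χ u : ℂˣ) : ℂ)) 0 (((k : GL (Fin 2) F) : Matrix (Fin 2) (Fin 2) F)).det‖ ≤ 1 :=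
    fun k => norm_extend_le_one χ hχ2 _
  have hWm : Measurable fun p : ↥(glInt 2 F) × F =>
      Function.extend ((↑) : Fˣ → F) (fun u => ((χ u : ℂˣ) : ℂ)) 0 (p.2 * (((p.1 : GL (Fin 2) F) : Matrix (Fin 2) (Fin 2) F)).det) :=
    (TateDirect.measurable_extend χ).comp (continuous_snd.mul (hdetc.comp continuous_fst)).measurable
  have hWb : ∀ p : ↥(glInt 2 F) × F,
      ‖Function.extend ((↑) : Fˣ → F) (fun u => ((χ u : ℂˣ) : ℂ)) 0 (p.2 * (((p.1 : GL (Fin 2) F) : Matrix (Fin 2) (Fin 2) F)).det)‖ ≤ 1 :=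
    fun p => norm_extend_le_one χ hχ2 _
  -- the modified weight `ω' = ω_n + (c₀/μ𝔭^{2n})·1_{𝔭^{2n}}` and the ball indicator weight
  have hμpos : 0 < dx.real (primePowBall F (2 * (n : ℤ))) := measureReal_primePowBall_pos dx _
  have hω'm := measurable_truncWeight_add_indicator χ n (c₀ / (dx.real (primePowBall F (2 * (n : ℤ))) : ℂ))
  have hω'b := norm_truncWeight_add_indicator_le χ hχ2 n (c₀ / (dx.real (primePowBall F (2 * (n : ℤ))) : ℂ))
  have hωm : Measurable fun y : F => (primePowBall F (2 * (n : ℤ)))ᶜ.indicator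
      (fun y => Function.extend ((↑) : Fˣ → F) (fun u => ((χ u : ℂˣ) : ℂ)) 0 y * ((((normAbs F y)⁻¹ : ℝ≥0) : ℝ) : ℂ)) y := by
    have := measurable_truncWeight_add_indicator χ n 0
    simpa only [zero_mul, add_zero] using this
  have hωb : ∀ y : F, ‖(primePowBall F (2 * (n : ℤ)))ᶜ.indicator
      (fun y => Function.extend ((↑) : Fˣ → F) (fun u => ((χ u : ℂˣ) : ℂ)) 0 y * ((((normAbs F y)⁻¹ : ℝ≥0) : ℝ) : ℂ)) y‖ ≤
      (residueFieldCard F : ℝ) ^ (2 * (n : ℤ)) := fun y => norm_truncWeight_le χ hχ2 _ y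
  have h1m : Measurable fun y : F => (primePowBall F (2 * (n : ℤ))).indicator (fun _ => (1 : ℂ)) y :=
    measurable_const.indicator (measurableSet_primePowBall _)
  have h1b : ∀ y : F, ‖(primePowBall F (2 * (n : ℤ))).indicator (fun _ => (1 : ℂ)) y‖ ≤ 1 := fun y => by
    by_cases hy : y ∈ primePowBall F (2 * (n : ℤ))
    · rw [Set.indicator_of_mem hy, norm_one]
    · rw [Set.indicator_of_notMem hy, norm_zero]; exact zero_le_one
  -- STEP 1: (L2′) with `W(k,t) = χ̃(t·det k)`
  have step1 := hL2 hf _ hWm hWb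
  simp only at step1
  rw [step1]
  -- STEP 2: per `k`, the line identity
  have step2 : ∀ k : ↥(glInt 2 F),
      ∫ t, Function.extend ((↑) : Fˣ → F) (fun u => ((χ u : ℂˣ) : ℂ)) 0 (t * (((k : GL (Fin 2) F) : Matrix (Fin 2) (Fin 2) F)).det) *
        fourierSB ψ dx (fun s : F => ∫ r : Fin 3 → F,
          f (((k : GL (Fin 2) F) : Matrix (Fin 2) (Fin 2) F) * !![r 0, r 1; s, r 2] * ((((k : GL (Fin 2) F))⁻¹ : GL (Fin 2) F) : Matrix (Fin 2) (Fin 2) F))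
            ∂(Measure.pi fun _ : Fin 3 => dx)) t ∂dx =
      Function.extend ((↑) : Fˣ → F) (fun u => ((χ u : ℂˣ) : ℂ)) 0 (((k : GL (Fin 2) F) : Matrix (Fin 2) (Fin 2) F)).det *
        (γ₀ * ∫ s, ((primePowBall F (2 * (n : ℤ)))ᶜ.indicator
            (fun y => Function.extend ((↑) : Fˣ → F) (fun u => ((χ u : ℂˣ) : ℂ)) 0 y * ((((normAbs F y)⁻¹ : ℝ≥0) : ℝ) : ℂ)) s +
          (c₀ / (dx.real (primePowBall F (2 * (n : ℤ))) : ℂ)) * (primePowBall F (2 * (n : ℤ))).indicator (fun _ => (1 : ℂ)) s) *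
          ∫ r : Fin 3 → F, f (((k : GL (Fin 2) F) : Matrix (Fin 2) (Fin 2) F) * !![r 0, r 1; s, r 2] *
            ((((k : GL (Fin 2) F))⁻¹ : GL (Fin 2) F) : Matrix (Fin 2) (Fin 2) F)) ∂(Measure.pi fun _ : Fin 3 => dx) ∂dx) := by
    intro k
    rw [integral_extend_mul_det_eq dx χ (k : GL (Fin 2) F),
      lineIntegral_eq_of_const_on_ball dx χ hχ2 hχ1 ψ hT1 (hSB k.2 hf).1 (fun s hs => hN k s hs) hNn]
  rw [integral_congr_ae (Eventually.of_forall step2)]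
  -- STEP 3: pull `γ₀` and apply (K1′) with the modified weight
  have step3 : ∫ k : ↥(glInt 2 F), Function.extend ((↑) : Fˣ → F) (fun u => ((χ u : ℂˣ) : ℂ)) 0 (((k : GL (Fin 2) F) : Matrix (Fin 2) (Fin 2) F)).det *
        (γ₀ * ∫ s, ((primePowBall F (2 * (n : ℤ)))ᶜ.indicator
            (fun y => Function.extend ((↑) : Fˣ → F) (fun u => ((χ u : ℂˣ) : ℂ)) 0 y * ((((normAbs F y)⁻¹ : ℝ≥0) : ℝ) : ℂ)) s +
          (c₀ / (dx.real (primePowBall F (2 * (n : ℤ))) : ℂ)) * (primePowBall F (2 * (n : ℤ))).indicator (fun _ => (1 : ℂ)) s) *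
          ∫ r : Fin 3 → F, f (((k : GL (Fin 2) F) : Matrix (Fin 2) (Fin 2) F) * !![r 0, r 1; s, r 2] *
            ((((k : GL (Fin 2) F))⁻¹ : GL (Fin 2) F) : Matrix (Fin 2) (Fin 2) F)) ∂(Measure.pi fun _ : Fin 3 => dx) ∂dx) ∂κ =
      γ₀ * ((c' : ℂ) * ∫ X, f X * ∫ k : ↥(glInt 2 F), Function.extend ((↑) : Fˣ → F) (fun u => ((χ u : ℂˣ) : ℂ)) 0 (((k : GL (Fin 2) F) : Matrix (Fin 2) (Fin 2) F)).det *
        ((primePowBall F (2 * (n : ℤ)))ᶜ.indicator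
            (fun y => Function.extend ((↑) : Fˣ → F) (fun u => ((χ u : ℂˣ) : ℂ)) 0 y * ((((normAbs F y)⁻¹ : ℝ≥0) : ℝ) : ℂ))
            ((((((k : GL (Fin 2) F))⁻¹ : GL (Fin 2) F) : Matrix (Fin 2) (Fin 2) F) * X * ((k : GL (Fin 2) F) : Matrix (Fin 2) (Fin 2) F)) 1 0) +
          (c₀ / (dx.real (primePowBall F (2 * (n : ℤ))) : ℂ)) * (primePowBall F (2 * (n : ℤ))).indicator (fun _ => (1 : ℂ))
            ((((((k : GL (Fin 2) F))⁻¹ : GL (Fin 2) F) : Matrix (Fin 2) (Fin 2) F) * X * ((k : GL (Fin 2) F) : Matrix (Fin 2) (Fin 2) F)) 1 0)) ∂κ ∂μ𝔤) := by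
    rw [← hK1 κ _ hχK hχKb _ _ hω'm hω'b f hf.continuous hf.2, ← integral_const_mul]
    refine integral_congr_ae (Eventually.of_forall fun k => ?_)
    simp only
    ring
  rw [step3]
  -- STEP 4: split the modified K-average: `A' = A_n + λ·D`
  have step4 : ∀ X : Matrix (Fin 2) (Fin 2) F,
      ∫ k : ↥(glInt 2 F), Function.extend ((↑) : Fˣ → F) (fun u => ((χ u : ℂˣ) : ℂ)) 0 (((k : GL (Fin 2) F) : Matrix (Fin 2) (Fin 2) F)).det *
        ((primePowBall F (2 * (n : ℤ)))ᶜ.indicator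
            (fun y => Function.extend ((↑) : Fˣ → F) (fun u => ((χ u : ℂˣ) : ℂ)) 0 y * ((((normAbs F y)⁻¹ : ℝ≥0) : ℝ) : ℂ))
            ((((((k : GL (Fin 2) F))⁻¹ : GL (Fin 2) F) : Matrix (Fin 2) (Fin 2) F) * X * ((k : GL (Fin 2) F) : Matrix (Fin 2) (Fin 2) F)) 1 0) +
          (c₀ / (dx.real (primePowBall F (2 * (n : ℤ))) : ℂ)) * (primePowBall F (2 * (n : ℤ))).indicator (fun _ => (1 : ℂ))
            ((((((k : GL (Fin 2) F))⁻¹ : GL (Fin 2) F) : Matrix (Fin 2) (Fin 2) F) * X * ((k : GL (Fin 2) F) : Matrix (Fin 2) (Fin 2) F)) 1 0)) ∂κ =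
      (∫ k : ↥(glInt 2 F), Function.extend ((↑) : Fˣ → F) (fun u => ((χ u : ℂˣ) : ℂ)) 0 (((k : GL (Fin 2) F) : Matrix (Fin 2) (Fin 2) F)).det *
        (primePowBall F (2 * (n : ℤ)))ᶜ.indicator
            (fun y => Function.extend ((↑) : Fˣ → F) (fun u => ((χ u : ℂˣ) : ℂ)) 0 y * ((((normAbs F y)⁻¹ : ℝ≥0) : ℝ) : ℂ))
            ((((((k : GL (Fin 2) F))⁻¹ : GL (Fin 2) F) : Matrix (Fin 2) (Fin 2) F) * X * ((k : GL (Fin 2) F) : Matrix (Fin 2) (Fin 2) F)) 1 0) ∂κ) +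
      (c₀ / (dx.real (primePowBall F (2 * (n : ℤ))) : ℂ)) * ∫ k : ↥(glInt 2 F), Function.extend ((↑) : Fˣ → F) (fun u => ((χ u : ℂˣ) : ℂ)) 0 (((k : GL (Fin 2) F) : Matrix (Fin 2) (Fin 2) F)).det *
        (primePowBall F (2 * (n : ℤ))).indicator (fun _ => (1 : ℂ))
            ((((((k : GL (Fin 2) F))⁻¹ : GL (Fin 2) F) : Matrix (Fin 2) (Fin 2) F) * X * ((k : GL (Fin 2) F) : Matrix (Fin 2) (Fin 2) F)) 1 0) ∂κ := by
    intro X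
    have hadd := twistedKAverage_add χ κ hχ2 hωm ((measurable_const (a := (c₀ / (dx.real (primePowBall F (2 * (n : ℤ))) : ℂ)))).mul h1m)
      (M₂ := ‖(c₀ / (dx.real (primePowBall F (2 * (n : ℤ))) : ℂ))‖ * 1) hωb (fun y => by rw [Pi.mul_apply, norm_mul]; exact mul_le_mul_of_nonneg_left (h1b y) (norm_nonneg _)) X
    simp only [Pi.add_apply, Pi.mul_apply] at hadd
    rw [hadd, twistedKAverage_const_mul χ κ]
  simp_rw [step4]
  -- STEP 5: split the `μ𝔤`-integral
  have hIA := integrable_mul_twistedKAverage χ κ hχ2 hωm hωb μ𝔤 hf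
  have hID := integrable_mul_twistedKAverage χ κ hχ2 h1m h1b μ𝔤 hf
  have step5 : ∫ X, f X * ((∫ k : ↥(glInt 2 F), Function.extend ((↑) : Fˣ → F) (fun u => ((χ u : ℂˣ) : ℂ)) 0 (((k : GL (Fin 2) F) : Matrix (Fin 2) (Fin 2) F)).det *
        (primePowBall F (2 * (n : ℤ)))ᶜ.indicator
            (fun y => Function.extend ((↑) : Fˣ → F) (fun u => ((χ u : ℂˣ) : ℂ)) 0 y * ((((normAbs F y)⁻¹ : ℝ≥0) : ℝ) : ℂ))
            ((((((k : GL (Fin 2) F))⁻¹ : GL (Fin 2) F) : Matrix (Fin 2) (Fin 2) F) * X * ((k : GL (Fin 2) F) : Matrix (Fin 2) (Fin 2) F)) 1 0) ∂κ) +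
      (c₀ / (dx.real (primePowBall F (2 * (n : ℤ))) : ℂ)) * ∫ k : ↥(glInt 2 F), Function.extend ((↑) : Fˣ → F) (fun u => ((χ u : ℂˣ) : ℂ)) 0 (((k : GL (Fin 2) F) : Matrix (Fin 2) (Fin 2) F)).det *
        (primePowBall F (2 * (n : ℤ))).indicator (fun _ => (1 : ℂ))
            ((((((k : GL (Fin 2) F))⁻¹ : GL (Fin 2) F) : Matrix (Fin 2) (Fin 2) F) * X * ((k : GL (Fin 2) F) : Matrix (Fin 2) (Fin 2) F)) 1 0) ∂κ) ∂μ𝔤 =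
      (∫ X, f X * ∫ k : ↥(glInt 2 F), Function.extend ((↑) : Fˣ → F) (fun u => ((χ u : ℂˣ) : ℂ)) 0 (((k : GL (Fin 2) F) : Matrix (Fin 2) (Fin 2) F)).det *
        (primePowBall F (2 * (n : ℤ)))ᶜ.indicator
            (fun y => Function.extend ((↑) : Fˣ → F) (fun u => ((χ u : ℂˣ) : ℂ)) 0 y * ((((normAbs F y)⁻¹ : ℝ≥0) : ℝ) : ℂ))
            ((((((k : GL (Fin 2) F))⁻¹ : GL (Fin 2) F) : Matrix (Fin 2) (Fin 2) F) * X * ((k : GL (Fin 2) F) : Matrix (Fin 2) (Fin 2) F)) 1 0) ∂κ ∂μ𝔤) +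
      (c₀ / (dx.real (primePowBall F (2 * (n : ℤ))) : ℂ)) * ∫ X, f X * ∫ k : ↥(glInt 2 F), Function.extend ((↑) : Fˣ → F) (fun u => ((χ u : ℂˣ) : ℂ)) 0 (((k : GL (Fin 2) F) : Matrix (Fin 2) (Fin 2) F)).det *
        (primePowBall F (2 * (n : ℤ))).indicator (fun _ => (1 : ℂ))
            ((((((k : GL (Fin 2) F))⁻¹ : GL (Fin 2) F) : Matrix (Fin 2) (Fin 2) F) * X * ((k : GL (Fin 2) F) : Matrix (Fin 2) (Fin 2) F)) 1 0) ∂κ ∂μ𝔤 := by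
    rw [← integral_const_mul, ← integral_add hIA (hID.const_mul _)]
    refine integral_congr_ae (Eventually.of_forall fun X => ?_)
    simp only
    ring
  rw [step5]
  -- STEP 6: the `D`-term is the zero term `∫ f·Fr₀` ((K1′) backwards, constancy on the ball, (K2) at `a = 1`)
  have step6 : (c' : ℂ) * ∫ X, f X * ∫ k : ↥(glInt 2 F), Function.extend ((↑) : Fˣ → F) (fun u => ((χ u : ℂˣ) : ℂ)) 0 (((k : GL (Fin 2) F) : Matrix (Fin 2) (Fin 2) F)).det *
        (primePowBall F (2 * (n : ℤ))).indicator (fun _ => (1 : ℂ))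
            ((((((k : GL (Fin 2) F))⁻¹ : GL (Fin 2) F) : Matrix (Fin 2) (Fin 2) F) * X * ((k : GL (Fin 2) F) : Matrix (Fin 2) (Fin 2) F)) 1 0) ∂κ ∂μ𝔤 =
      (dx.real (primePowBall F (2 * (n : ℤ))) : ℂ) * ∫ X, f X * Fr₀ X ∂μ𝔤 := by
    rw [← hK1 κ _ hχK hχKb _ _ h1m h1b f hf.continuous hf.2]
    -- per `k`: `∫ 1_B·G_k = μ(B)·G_k(0)`
    have hk : ∀ k : ↥(glInt 2 F), ∫ s, (primePowBall F (2 * (n : ℤ))).indicator (fun _ => (1 : ℂ)) s *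
        ∫ r : Fin 3 → F, f (((k : GL (Fin 2) F) : Matrix (Fin 2) (Fin 2) F) * !![r 0, r 1; s, r 2] *
          ((((k : GL (Fin 2) F))⁻¹ : GL (Fin 2) F) : Matrix (Fin 2) (Fin 2) F)) ∂(Measure.pi fun _ : Fin 3 => dx) ∂dx =
        (dx.real (primePowBall F (2 * (n : ℤ))) : ℂ) * ∫ r : Fin 3 → F, f (((k : GL (Fin 2) F) : Matrix (Fin 2) (Fin 2) F) * !![r 0, r 1; 0, r 2] *
          ((((k : GL (Fin 2) F))⁻¹ : GL (Fin 2) F) : Matrix (Fin 2) (Fin 2) F)) ∂(Measure.pi fun _ : Fin 3 => dx) := by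
      intro k
      have : (fun s => (primePowBall F (2 * (n : ℤ))).indicator (fun _ => (1 : ℂ)) s *
          ∫ r : Fin 3 → F, f (((k : GL (Fin 2) F) : Matrix (Fin 2) (Fin 2) F) * !![r 0, r 1; s, r 2] *
            ((((k : GL (Fin 2) F))⁻¹ : GL (Fin 2) F) : Matrix (Fin 2) (Fin 2) F)) ∂(Measure.pi fun _ : Fin 3 => dx)) =
          (primePowBall F (2 * (n : ℤ))).indicator (fun s => ∫ r : Fin 3 → F, f (((k : GL (Fin 2) F) : Matrix (Fin 2) (Fin 2) F) * !![r 0, r 1; s, r 2] *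
            ((((k : GL (Fin 2) F))⁻¹ : GL (Fin 2) F) : Matrix (Fin 2) (Fin 2) F)) ∂(Measure.pi fun _ : Fin 3 => dx)) := by
        funext s
        by_cases hs : s ∈ primePowBall F (2 * (n : ℤ))
        · rw [Set.indicator_of_mem hs, Set.indicator_of_mem hs, one_mul]
        · rw [Set.indicator_of_notMem hs, Set.indicator_of_notMem hs, zero_mul]
      rw [this, integral_indicator (measurableSet_primePowBall _)]
      have hball : ∀ s ∈ primePowBall F (2 * (n : ℤ)),
          ∫ r : Fin 3 → F, f (((k : GL (Fin 2) F) : Matrix (Fin 2) (Fin 2) F) * !![r 0, r 1; s, r 2] *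
            ((((k : GL (Fin 2) F))⁻¹ : GL (Fin 2) F) : Matrix (Fin 2) (Fin 2) F)) ∂(Measure.pi fun _ : Fin 3 => dx) =
          ∫ r : Fin 3 → F, f (((k : GL (Fin 2) F) : Matrix (Fin 2) (Fin 2) F) * !![r 0, r 1; 0, r 2] *
            ((((k : GL (Fin 2) F))⁻¹ : GL (Fin 2) F) : Matrix (Fin 2) (Fin 2) F)) ∂(Measure.pi fun _ : Fin 3 => dx) :=
        fun s hs => hN k s (primePowBall_antitone hNn hs)
      rw [setIntegral_congr_fun (measurableSet_primePowBall _) hball, setIntegral_const, Complex.real_smul]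
    simp_rw [hk]
    have hpull : ∫ k : ↥(glInt 2 F), Function.extend ((↑) : Fˣ → F) (fun u => ((χ u : ℂˣ) : ℂ)) 0 (((k : GL (Fin 2) F) : Matrix (Fin 2) (Fin 2) F)).det *
        ((dx.real (primePowBall F (2 * (n : ℤ))) : ℂ) * ∫ r : Fin 3 → F, f (((k : GL (Fin 2) F) : Matrix (Fin 2) (Fin 2) F) * !![r 0, r 1; 0, r 2] *
          ((((k : GL (Fin 2) F))⁻¹ : GL (Fin 2) F) : Matrix (Fin 2) (Fin 2) F)) ∂(Measure.pi fun _ : Fin 3 => dx)) ∂κ =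
        (dx.real (primePowBall F (2 * (n : ℤ))) : ℂ) * ∫ k : ↥(glInt 2 F), Function.extend ((↑) : Fˣ → F) (fun u => ((χ u : ℂˣ) : ℂ)) 0
          (((1 : Fˣ) : F)⁻¹ * (((k : GL (Fin 2) F) : Matrix (Fin 2) (Fin 2) F)).det) *
          ∫ r : Fin 3 → F, f (((k : GL (Fin 2) F) : Matrix (Fin 2) (Fin 2) F) * !![r 0, r 1; 0, r 2] *
            ((((k : GL (Fin 2) F))⁻¹ : GL (Fin 2) F) : Matrix (Fin 2) (Fin 2) F)) ∂(Measure.pi fun _ : Fin 3 => dx) ∂κ := by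
      rw [← integral_const_mul]
      refine integral_congr_ae (Eventually.of_forall fun k => ?_)
      simp only [Units.val_one, inv_one, one_mul]
      ring
    rw [hpull, hFr₀rep f hf]
  -- assemble the constants
  have hne : (dx.real (primePowBall F (2 * (n : ℤ))) : ℂ) ≠ 0 := by exact_mod_cast hμpos.ne'
  have hlam : (c₀ / (dx.real (primePowBall F (2 * (n : ℤ))) : ℂ)) * (dx.real (primePowBall F (2 * (n : ℤ))) : ℂ) = c₀ := div_mul_cancel₀ c₀ hne
  linear_combination ((c : ℂ) * γ₀ * (c₀ / (dx.real (primePowBall F (2 * (n : ℤ))) : ℂ))) * step6 +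
    ((c : ℂ) * γ₀ * ∫ X, f X * Fr₀ X ∂μ𝔤) * hlam

end Summit.HodgeConjecture.HodgeConjecture.Cruxes.H413.K2E3GL2TwistedNilpotentFourierChain

end
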